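import Summits.NavierStokesRegularity.NavierStokesRegularity.Theorems.HodographBetchovClassBudgetsRegulariseAlgebra
import Summits.NavierStokesRegularity.NavierStokesRegularity.Theorems.HodographBetchovClassBudgetsRegulariseHodograph
import Literature.Analysis.FluidPDE.SerrinEnstrophyGronwall
import Literature.Analysis.FluidPDE.EnstrophySplittingDissipation
import Summits.NavierStokesRegularity.NavierStokesRegularity.Theorems.HodographBetchovClassBudgetsRegulariseTransport

/-!
# Crux `HodographBetchov.ClassBudgetsRegularise` (stmt-NavierStokesRegularity-16863), line `birth` —
# the enstrophy production identity at a fixed time (helper for stub 1)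

For one time slice `v = u(t)`, `W = ∂ₜu(t)`, `q = p(t)` of a classical solution in Tao's class
(`v ∈ C³` divergence free and bounded with bounded gradient, `Dv, D²v, D³v, W, DW, q, Dq ∈ L²`,
momentum equation `W + (v·∇)v = νΔv − ∇q`):

  `∫ Σᵢ ⟪∂ᵢv, ∂ᵢW⟫ = −ν ∫ ‖Δv‖² + ∫ ⟪ω, ∇v ω⟫`,  `ω = curl v`

(`enstrophy_production_identity`; in differential form `½ d/dt ‖∇u‖² = −ν‖Δu‖² + ∫ ω·Sω`,
Lemarié-Rieusset 2016, (7.20)/(11.9); Majda–Bertozzi 2002, (1.29)–(1.33)). Steps: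
`∫ Σᵢ⟪∂ᵢv, ∂ᵢW⟫ = −∫⟪Δv, W⟫` and the pressure term vanishes (tree:
`integral_sum_inner_fderiv_fderiv_eq_neg_integral_inner_laplacian`,
`integral_inner_gradient_eq_zero_of_isDivFree_R3`), so `= −ν‖Δv‖² + ∫⟪Δv, (v·∇)v⟫`; one more
integration by parts gives `∫⟪Δv, (v·∇)v⟫ = −∫ Σᵢ⟪∂ᵢv, ∂ᵢ((v·∇)v)⟫ = −∫ Σᵢ⟪∂ᵢv, (v·∇)∂ᵢv⟫ − ∫ tr((∇v)ᵀ(∇v)²)`;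
the transport term is `−½∫⟪v, ∇|∇v|²⟫ = 0` (`div v = 0`; `integral_sum_inner_fderiv_transport_eq_zero`,
file `HodographBetchovClassBudgetsRegulariseTransport.lean`),
and by the cubic identity `tr(AᵀA²) = 3 det A − ⟪ω, Aω⟫` (`cubic_identity`) together with the
null-Lagrangian identity `∫ det ∇v = 0` (`integral_det_fderiv_eq_zero`) the cubic term is the
vortex stretching `∫⟪ω, ∇v ω⟫`.

References: P. G. Lemarié-Rieusset, *The Navier–Stokes Problem in the 21st Century* (2016),
(7.20), (11.9); A. J. Majda, A. L. Bertozzi, *Vorticity and Incompressible Flow* (2002), §1.2.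
-/

noncomputable section

open MeasureTheory Set Function Filter Topology InnerProductSpace
open scoped ENNReal NNReal ContDiff RealInnerProductSpace Laplacian

-- the summit and its single sub-problem share the name (CONVENTIONS §1), as in every Theorems file
set_option linter.dupNamespace false

namespace Summit.NavierStokesRegularity.NavierStokesRegularity.Theorems.ClassBudgetsRegularise

open Literature.Analysis Literature.Analysis.FluidPDE

/-- **The enstrophy production identity at a fixed time** (Lemarié-Rieusset 2016, (7.20)/(11.9):
`½ d/dt ∫|∇u|² = −ν∫|Δu|² + ∫ ω·Sω`, slice form). Let `v ∈ C³(ℝ³; ℝ³)` be divergence free, bounded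
with bounded gradient, `W ∈ C¹`, `q ∈ C¹`, with the momentum equation `W + (v·∇)v = νΔv − ∇q` and
`Dv, D²v, D³v, W, DW, q, Dq ∈ L²`. Then, with `ω = curl v`,
`∫ Σᵢ ⟪∂ᵢv, ∂ᵢW⟫ = −ν ∫ ‖Δv‖² + ∫ ⟪ω, ∇v ω⟫`.
Proof: `∫Σᵢ⟪∂ᵢv,∂ᵢW⟫ = −∫⟪Δv, W⟫ = −ν∫‖Δv‖² + ∫⟪Δv, (v·∇)v⟫` (the pressure term vanishes since
`div Δv = 0`); `∫⟪Δv, (v·∇)v⟫ = −∫Σᵢ⟪∂ᵢv, ∂ᵢ((v·∇)v)⟫ = −∫Σᵢ⟪∂ᵢv, (v·∇)∂ᵢv⟫ − ∫ tr((∇v)ᵀ(∇v)²)`,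
the transport term vanishes (`integral_sum_inner_fderiv_transport_eq_zero`), and
`tr(AᵀA²) = 3 det A − ⟪ω, Aω⟫` (`cubic_identity`) with `∫ det ∇v = 0`
(`integral_det_fderiv_eq_zero`). [cite: LemarieRieusset2016, Thm. 11.2 with (11.9)] -/
theorem enstrophy_production_identity {ν : ℝ}
    {v W : EuclideanSpace ℝ (Fin 3) → EuclideanSpace ℝ (Fin 3)} {q : EuclideanSpace ℝ (Fin 3) → ℝ}
    (hv : ContDiff ℝ 3 v) (hW : ContDiff ℝ 1 W) (hq : ContDiff ℝ 1 q)
    (hmom : ∀ x, W x + FluidPDE.convect v v x = ν • (Δ v) x - gradient q x)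
    (hdiv : VectorCalculus.IsDivFree v) {B : ℝ} (hB : ∀ x, ‖v x‖ ≤ B)
    {K : ℝ} (hK : ∀ x, ‖fderiv ℝ v x‖ ≤ K)
    (hv1 : ∫⁻ x, ‖iteratedFDeriv ℝ 1 v x‖ₑ ^ 2 < ⊤) (hv2 : ∫⁻ x, ‖iteratedFDeriv ℝ 2 v x‖ₑ ^ 2 < ⊤)
    (hv3 : ∫⁻ x, ‖iteratedFDeriv ℝ 3 v x‖ₑ ^ 2 < ⊤)
    (hW0 : ∫⁻ x, ‖W x‖ₑ ^ 2 < ⊤) (hW1 : ∫⁻ x, ‖iteratedFDeriv ℝ 1 W x‖ₑ ^ 2 < ⊤)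
    (hq0 : ∫⁻ x, ‖q x‖ₑ ^ 2 < ⊤) (hq1 : ∫⁻ x, ‖iteratedFDeriv ℝ 1 q x‖ₑ ^ 2 < ⊤) :
    ∫ x, ∑ i, ⟪fderiv ℝ v x (EuclideanSpace.basisFun (Fin 3) ℝ i),
        fderiv ℝ W x (EuclideanSpace.basisFun (Fin 3) ℝ i)⟫ =
      -(ν * ∫ x, ‖(Δ v) x‖ ^ 2) + ∫ x, ⟪curl v x, fderiv ℝ v x (curl v x)⟫ := by
  set e := EuclideanSpace.basisFun (Fin 3) ℝ with he
  have he1 : ∀ i, ‖e i‖ = 1 := fun i => by simp [he]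
  have hB0 : 0 ≤ B := (norm_nonneg _).trans (hB 0)
  have hK0 : 0 ≤ K := (norm_nonneg _).trans (hK 0)
  -- smoothness and continuity (as in the tree's Serrin slice bound)
  have hv2' : ContDiff ℝ 2 v := hv.of_le (by norm_num)
  have hv1' : ContDiff ℝ 1 v := hv.of_le (by norm_num)
  have hΔ1 : ContDiff ℝ 1 (Δ v) := contDiff_one_laplacian_of_contDiff_three hv
  have cv : Continuous v := hv.continuous
  have cDv : Continuous (fderiv ℝ v) := hv.continuous_fderiv (by norm_num)
  have cD2 : Continuous fun x => iteratedFDeriv ℝ 2 v x := hv.continuous_iteratedFDeriv (by norm_num)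
  have cD3 : Continuous fun x => iteratedFDeriv ℝ 3 v x := hv.continuous_iteratedFDeriv (by norm_num)
  have cdiv : ∀ i, Continuous fun x => fderiv ℝ v x (e i) := fun i => cDv.clm_apply continuous_const
  have cddv : ∀ i, Continuous fun x => fderiv ℝ (fun y => fderiv ℝ v y (e i)) x (e i) := fun i =>
    ((((hv.fderiv_right (m := 2) (by norm_num)).clm_apply contDiff_const).continuous_fderiv
      (by norm_num)).clm_apply continuous_const)
  have cW : Continuous W := hW.continuous
  have cDW : Continuous (fderiv ℝ W) := hW.continuous_fderiv one_ne_zero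
  have cdiW : ∀ i, Continuous fun x => fderiv ℝ W x (e i) := fun i => cDW.clm_apply continuous_const
  have cq : Continuous q := hq.continuous
  have cDq : Continuous (fderiv ℝ q) := hq.continuous_fderiv one_ne_zero
  have cdiq : ∀ i, Continuous fun x => fderiv ℝ q x (e i) := fun i => cDq.clm_apply continuous_const
  have cgq : Continuous (gradient q) := by
    have : gradient q = fun x => (InnerProductSpace.toDual ℝ _).symm (fderiv ℝ q x) := rfl
    rw [this]
    exact (InnerProductSpace.toDual ℝ (EuclideanSpace ℝ (Fin 3))).symm.continuous.comp cDq
  have cΔ : Continuous (Δ v) := hΔ1.continuous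
  have cdΔ : ∀ i, Continuous fun x => fderiv ℝ (Δ v) x (e i) := fun i =>
    (hΔ1.continuous_fderiv one_ne_zero).clm_apply continuous_const
  have cconv : Continuous (FluidPDE.convect v v) := cDv.clm_apply cv
  have c3D2 : Continuous fun x => (3 : ℝ) • iteratedFDeriv ℝ 2 v x := cD2.const_smul (3 : ℝ)
  have c3D3 : Continuous fun x => (3 : ℝ) • iteratedFDeriv ℝ 3 v x := cD3.const_smul (3 : ℝ)
  -- pointwise norm bounds
  have hDv_eq : ∀ x, ‖fderiv ℝ v x‖ = ‖iteratedFDeriv ℝ 1 v x‖ := fun x => by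
    rw [← norm_iteratedFDeriv_fderiv, norm_iteratedFDeriv_zero]
  have n_Δ : ∀ x, ‖(Δ v) x‖ ≤ ‖(3 : ℝ) • iteratedFDeriv ℝ 2 v x‖ := fun x => by
    rw [norm_smul, Real.norm_of_nonneg (by norm_num : (0 : ℝ) ≤ 3)]
    exact norm_laplacian_le_three_mul_norm_iteratedFDeriv_two hv2' x
  have n_dΔ : ∀ i x, ‖fderiv ℝ (Δ v) x (e i)‖ ≤ ‖(3 : ℝ) • iteratedFDeriv ℝ 3 v x‖ := fun i x => by
    rw [norm_smul, Real.norm_of_nonneg (by norm_num : (0 : ℝ) ≤ 3),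
      fderiv_laplacian_apply_of_contDiff_three hv x (e i)]
    exact (norm_laplacian_le_three_mul_norm_iteratedFDeriv_two
      ((hv.fderiv_right (m := 2) (by norm_num)).clm_apply contDiff_const) x).trans
      (mul_le_mul_of_nonneg_left (norm_iteratedFDeriv_fderiv_apply_basisFun_le hv 2 (by norm_num) x i)
        (by norm_num))
  have n_conv : ∀ x, ‖FluidPDE.convect v v x‖ ≤ ‖B • ‖fderiv ℝ v x‖‖ := fun x => by
    rw [FluidPDE.convect, smul_eq_mul, Real.norm_of_nonneg (mul_nonneg hB0 (norm_nonneg _)), mul_comm]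
    exact (fderiv ℝ v x).le_opNorm_of_le (hB x)
  have hin : ∀ i (y : EuclideanSpace ℝ (Fin 3)), ‖⟪e i, y⟫‖ ≤ ‖y‖ := fun i y =>
    (norm_inner_le_norm (𝕜 := ℝ) (e i) y).trans (by rw [he1, one_mul])
  -- finite `L²` norms
  have l2Dv : ∫⁻ x, ‖fderiv ℝ v x‖ₑ ^ 2 < ⊤ :=
    lintegral_enorm_sq_lt_top_of_norm_le (fun x => (hDv_eq x).le) hv1
  have l2Δ : ∫⁻ x, ‖(3 : ℝ) • iteratedFDeriv ℝ 2 v x‖ₑ ^ 2 < ⊤ := lintegral_enorm_sq_const_smul_lt_top (3 : ℝ) hv2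
  have l2dΔ : ∫⁻ x, ‖(3 : ℝ) • iteratedFDeriv ℝ 3 v x‖ₑ ^ 2 < ⊤ := lintegral_enorm_sq_const_smul_lt_top (3 : ℝ) hv3
  have l2Dv' : ∫⁻ x, ‖‖fderiv ℝ v x‖‖ₑ ^ 2 < ⊤ := by simpa only [enorm_norm] using l2Dv
  have l2BDv : ∫⁻ x, ‖B • ‖fderiv ℝ v x‖‖ₑ ^ 2 < ⊤ := lintegral_enorm_sq_const_smul_lt_top B l2Dv'
  have cBDv : Continuous fun x => B • ‖fderiv ℝ v x‖ := cDv.norm.const_smul B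
  have l2diq : ∀ i, ∫⁻ x, ‖fderiv ℝ q x (e i)‖ₑ ^ 2 < ⊤ := fun i =>
    lintegral_enorm_sq_lt_top_of_norm_le (fun x => norm_fderiv_apply_basisFun_le q x i) hq1
  have l2ddv : ∀ i, ∫⁻ x, ‖fderiv ℝ (fun y => fderiv ℝ v y (e i)) x (e i)‖ₑ ^ 2 < ⊤ := fun i =>
    lintegral_enorm_sq_lt_top_of_norm_le (fun x => norm_fderiv_fderiv_apply_basisFun_le hv2' x i) hv2
  have l2div : ∀ i, ∫⁻ x, ‖fderiv ℝ v x (e i)‖ₑ ^ 2 < ⊤ := fun i =>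
    lintegral_enorm_sq_lt_top_of_norm_le (fun x => by
      simpa [he1] using (fderiv ℝ v x).le_opNorm (e i)) l2Dv
  have l2diW : ∀ i, ∫⁻ x, ‖fderiv ℝ W x (e i)‖ₑ ^ 2 < ⊤ := fun i =>
    lintegral_enorm_sq_lt_top_of_norm_le (fun x => norm_fderiv_apply_basisFun_le W x i) hW1
  have l2conv : ∫⁻ x, ‖FluidPDE.convect v v x‖ₑ ^ 2 < ⊤ :=
    lintegral_enorm_sq_lt_top_of_norm_le n_conv l2BDv
  -- integrability of the products
  have i1 : ∀ i, Integrable (fun x => ⟪fderiv ℝ (fun y => fderiv ℝ v y (e i)) x (e i), W x⟫)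
      volume := fun i =>
    integrable_of_norm_le_mul_of_lintegral_sq ((cddv i).inner cW).aestronglyMeasurable (cddv i) cW
      (l2ddv i) hW0 fun x => norm_inner_le_norm _ _
  have i2 : ∀ i, Integrable (fun x => ⟪fderiv ℝ v x (e i), fderiv ℝ W x (e i)⟫) volume := fun i =>
    integrable_of_norm_le_mul_of_lintegral_sq ((cdiv i).inner (cdiW i)).aestronglyMeasurable
      (cdiv i) (cdiW i) (l2div i) (l2diW i) fun x => norm_inner_le_norm _ _
  have i3 : ∀ i, Integrable (fun x => ⟪fderiv ℝ v x (e i), W x⟫) volume := fun i =>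
    integrable_of_norm_le_mul_of_lintegral_sq ((cdiv i).inner cW).aestronglyMeasurable (cdiv i) cW
      (l2div i) hW0 fun x => norm_inner_le_norm _ _
  have iΔΔ : Integrable (fun x => ‖(Δ v) x‖ ^ 2) volume :=
    FluidPDE.integrable_sq_norm_of_lintegral_lt_top cΔ (lintegral_enorm_sq_lt_top_of_norm_le n_Δ l2Δ)
  have iΔg : Integrable (fun x => ⟪(Δ v) x, gradient q x⟫) volume := by
    have l2gq : ∫⁻ x, ‖gradient q x‖ₑ ^ 2 < ⊤ := by
      refine lintegral_enorm_sq_lt_top_of_norm_le (fun x => le_of_eq ?_) hq1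
      rw [gradient, LinearIsometryEquiv.norm_map, ← norm_iteratedFDeriv_fderiv, norm_iteratedFDeriv_zero]
    exact integrable_of_norm_le_mul_of_lintegral_sq (cΔ.inner cgq).aestronglyMeasurable c3D2 cgq
      l2Δ l2gq fun x => (norm_inner_le_norm _ _).trans
        (mul_le_mul_of_nonneg_right (n_Δ x) (norm_nonneg _))
  have iΔW : Integrable (fun x => ⟪(Δ v) x, W x⟫) volume :=
    integrable_of_norm_le_mul_of_lintegral_sq (cΔ.inner cW).aestronglyMeasurable c3D2 cW l2Δ hW0
      fun x => (norm_inner_le_norm _ _).trans (mul_le_mul_of_nonneg_right (n_Δ x) (norm_nonneg _))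
  have iΔc : Integrable (fun x => ⟪(Δ v) x, FluidPDE.convect v v x⟫) volume :=
    integrable_of_norm_le_mul_of_lintegral_sq (cΔ.inner cconv).aestronglyMeasurable c3D2
      cBDv l2Δ l2BDv
      fun x => (norm_inner_le_norm _ _).trans (mul_le_mul (n_Δ x) (n_conv x) (norm_nonneg _) (norm_nonneg _))
  -- Step 1: `∫ Σᵢ ⟪∂ᵢv, ∂ᵢW⟫ = -∫ ⟪Δv, W⟫`
  have hL := integral_sum_inner_fderiv_fderiv_eq_neg_integral_inner_laplacian hv2' hW i1 i2 i3
  -- Step 2: the pressure term vanishes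
  have hpress : ∫ x, ⟪(Δ v) x, gradient q x⟫ = 0 := by
    have hswap : (fun x => ⟪(Δ v) x, gradient q x⟫) = fun x => ⟪gradient q x, (Δ v) x⟫ :=
      funext fun x => real_inner_comm _ _
    rw [hswap]
    refine integral_inner_gradient_eq_zero_of_isDivFree_R3 hq hΔ1
      (isDivFree_laplacian_of_contDiff_three hv hdiv) (fun i => ?_) (fun i => ?_) (fun i => ?_)
    · refine integrable_of_norm_le_mul_of_lintegral_sq
        ((continuous_const.inner cΔ).mul (cdiq i)).aestronglyMeasurable c3D2 (cdiq i) l2Δ (l2diq i)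
        fun x => ?_
      rw [norm_mul]
      exact mul_le_mul ((hin i _).trans (n_Δ x)) le_rfl (norm_nonneg _) (norm_nonneg _)
    · refine integrable_of_norm_le_mul_of_lintegral_sq
        ((continuous_const.inner (cdΔ i)).mul cq).aestronglyMeasurable c3D3 cq l2dΔ hq0
        fun x => ?_
      rw [norm_mul]
      exact mul_le_mul ((hin i _).trans (n_dΔ i x)) le_rfl (norm_nonneg _) (norm_nonneg _)
    · refine integrable_of_norm_le_mul_of_lintegral_sq
        ((continuous_const.inner cΔ).mul cq).aestronglyMeasurable c3D2 cq l2Δ hq0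
        fun x => ?_
      rw [norm_mul]
      exact mul_le_mul ((hin i _).trans (n_Δ x)) le_rfl (norm_nonneg _) (norm_nonneg _)
  -- Step 3: `∫ ⟪Δv, W⟫ = ν ∫ ‖Δv‖² - ∫ ⟪Δv, (v·∇)v⟫`
  have hΔW : ∫ x, ⟪(Δ v) x, W x⟫ = ν * (∫ x, ‖(Δ v) x‖ ^ 2) - ∫ x, ⟪(Δ v) x, FluidPDE.convect v v x⟫ := by
    have hpt : ∀ x, ⟪(Δ v) x, W x⟫ =
        ν * ‖(Δ v) x‖ ^ 2 - ⟪(Δ v) x, FluidPDE.convect v v x⟫ - ⟪(Δ v) x, gradient q x⟫ := by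
      intro x
      have hWx : W x = ν • (Δ v) x - FluidPDE.convect v v x - gradient q x := by
        have h : W x = ν • (Δ v) x - gradient q x - FluidPDE.convect v v x :=
          eq_sub_iff_add_eq.2 (hmom x)
        rw [h]; abel
      rw [hWx, inner_sub_right, inner_sub_right, inner_smul_right, real_inner_self_eq_norm_sq]
    have e1 : ∫ x, ⟪(Δ v) x, W x⟫ =
        ∫ x, (ν * ‖(Δ v) x‖ ^ 2 - ⟪(Δ v) x, FluidPDE.convect v v x⟫ - ⟪(Δ v) x, gradient q x⟫) :=
      integral_congr_ae (Eventually.of_forall hpt)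
    have e2 : ∫ x, (ν * ‖(Δ v) x‖ ^ 2 - ⟪(Δ v) x, FluidPDE.convect v v x⟫ - ⟪(Δ v) x, gradient q x⟫) =
        (∫ x, (ν * ‖(Δ v) x‖ ^ 2 - ⟪(Δ v) x, FluidPDE.convect v v x⟫)) - ∫ x, ⟪(Δ v) x, gradient q x⟫ :=
      integral_sub ((iΔΔ.const_mul ν).sub iΔc) iΔg
    have e3 : ∫ x, (ν * ‖(Δ v) x‖ ^ 2 - ⟪(Δ v) x, FluidPDE.convect v v x⟫) =
        (∫ x, ν * ‖(Δ v) x‖ ^ 2) - ∫ x, ⟪(Δ v) x, FluidPDE.convect v v x⟫ :=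
      integral_sub (iΔΔ.const_mul ν) iΔc
    have e4 : ∫ x, ν * ‖(Δ v) x‖ ^ 2 = ν * ∫ x, ‖(Δ v) x‖ ^ 2 := integral_const_mul _ _
    rw [e1, e2, e3, e4, hpress, sub_zero]
  -- Step 4: `∫ ⟪Δv, (v·∇)v⟫ = -∫ Σᵢ ⟪∂ᵢv, ∂ᵢ((v·∇)v)⟫`
  set Cv : EuclideanSpace ℝ (Fin 3) → EuclideanSpace ℝ (Fin 3) := FluidPDE.convect v v with hCv
  have hCv2 : ContDiff ℝ 2 Cv := by
    have : Cv = fun x => fderiv ℝ v x (v x) := rfl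
    rw [this]
    exact (hv.fderiv_right (m := 2) (by norm_num)).clm_apply hv2'
  have hCv1 : ContDiff ℝ 1 Cv := hCv2.of_le (by norm_num)
  have hdDv : ∀ x, DifferentiableAt ℝ (fderiv ℝ v) x := fun x =>
    ((hv.fderiv_right (m := 2) (by norm_num)).differentiable (by norm_num)) x
  have hdv : ∀ x, DifferentiableAt ℝ v x := fun x => (hv.differentiable (by norm_num)) x
  -- the derivative of `(v·∇)v`: `∂ᵢ((v·∇)v) = D(∂ᵢv)(v) + Dv (∂ᵢv)`
  have hDCv : ∀ x i, fderiv ℝ Cv x (e i) =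
      fderiv ℝ (fun y => fderiv ℝ v y (e i)) x (v x) + fderiv ℝ v x (fderiv ℝ v x (e i)) := by
    intro x i
    have h1 : fderiv ℝ Cv x (e i) = fderiv ℝ v x (fderiv ℝ v x (e i)) + fderiv ℝ (fderiv ℝ v) x (e i) (v x) := by
      have : Cv = fun y => fderiv ℝ v y (v y) := rfl
      rw [this, fderiv_clm_apply (hdDv x) (hdv x)]
      simp
    rw [h1, add_comm, ← FluidPDE.fderiv_apply_const_apply (hdDv x) (v x) (e i),
      fderiv_fderiv_apply_comm_of_contDiff_two hv2' x (v x) (e i)]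
  have cdCv : ∀ i, Continuous fun x => fderiv ℝ Cv x (e i) := fun i =>
    (hCv1.continuous_fderiv one_ne_zero).clm_apply continuous_const
  have cDfi : ∀ i, Continuous fun x => fderiv ℝ (fun y => fderiv ℝ v y (e i)) x (v x) := fun i =>
    ((((hv.fderiv_right (m := 2) (by norm_num)).clm_apply contDiff_const).continuous_fderiv
      (by norm_num)).clm_apply cv)
  have n_Dfi : ∀ i x, ‖fderiv ℝ (fun y => fderiv ℝ v y (e i)) x (v x)‖ ≤ ‖B • iteratedFDeriv ℝ 2 v x‖ := by
    intro i x
    rw [norm_smul, Real.norm_of_nonneg hB0, FluidPDE.fderiv_apply_const_apply (hdDv x) (e i) (v x)]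
    calc ‖fderiv ℝ (fderiv ℝ v) x (v x) (e i)‖ ≤ ‖fderiv ℝ (fderiv ℝ v) x (v x)‖ * ‖e i‖ :=
          (fderiv ℝ (fderiv ℝ v) x (v x)).le_opNorm _
      _ ≤ ‖fderiv ℝ (fderiv ℝ v) x‖ * ‖v x‖ * ‖e i‖ := by
          gcongr; exact (fderiv ℝ (fderiv ℝ v) x).le_opNorm _
      _ ≤ ‖iteratedFDeriv ℝ 2 v x‖ * B * 1 := by
          have hn2 : ‖fderiv ℝ (fderiv ℝ v) x‖ = ‖iteratedFDeriv ℝ 2 v x‖ := by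
            rw [← norm_iteratedFDeriv_zero (𝕜 := ℝ) (f := fderiv ℝ (fderiv ℝ v)),
              norm_iteratedFDeriv_fderiv, norm_iteratedFDeriv_fderiv]
          rw [he1, hn2]
          gcongr
          exact hB x
      _ = B * ‖iteratedFDeriv ℝ 2 v x‖ := by ring
  have l2B2 : ∫⁻ x, ‖B • iteratedFDeriv ℝ 2 v x‖ₑ ^ 2 < ⊤ := lintegral_enorm_sq_const_smul_lt_top B hv2
  have l2KDv : ∫⁻ x, ‖K • ‖fderiv ℝ v x‖‖ₑ ^ 2 < ⊤ := lintegral_enorm_sq_const_smul_lt_top K l2Dv'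
  have cKDv : Continuous fun x => K • ‖fderiv ℝ v x‖ := cDv.norm.const_smul K
  have n_AA : ∀ i x, ‖fderiv ℝ v x (fderiv ℝ v x (e i))‖ ≤ ‖K • ‖fderiv ℝ v x‖‖ := by
    intro i x
    rw [smul_eq_mul, Real.norm_of_nonneg (mul_nonneg hK0 (norm_nonneg _))]
    calc ‖fderiv ℝ v x (fderiv ℝ v x (e i))‖ ≤ ‖fderiv ℝ v x‖ * ‖fderiv ℝ v x (e i)‖ :=
          (fderiv ℝ v x).le_opNorm _
      _ ≤ ‖fderiv ℝ v x‖ * (‖fderiv ℝ v x‖ * ‖e i‖) := by gcongr; exact (fderiv ℝ v x).le_opNorm _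
      _ ≤ ‖fderiv ℝ v x‖ * (K * 1) := by rw [he1]; gcongr; exact hK x
      _ = K * ‖fderiv ℝ v x‖ := by ring
  have l2dCv : ∀ i, ∫⁻ x, ‖fderiv ℝ Cv x (e i)‖ₑ ^ 2 < ⊤ := by
    intro i
    refine lintegral_enorm_sq_lt_top_of_norm_le_add (b := fun x => B • iteratedFDeriv ℝ 2 v x)
      (c := fun x => K • ‖fderiv ℝ v x‖) (fun x => ?_) (cD2.const_smul B).aestronglyMeasurable l2B2 l2KDv
    rw [hDCv x i]
    exact (norm_add_le _ _).trans (add_le_add (n_Dfi i x) (n_AA i x))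
  have j1 : ∀ i, Integrable (fun x => ⟪fderiv ℝ (fun y => fderiv ℝ v y (e i)) x (e i), Cv x⟫)
      volume := fun i =>
    integrable_of_norm_le_mul_of_lintegral_sq ((cddv i).inner cconv).aestronglyMeasurable (cddv i)
      cBDv (l2ddv i) l2BDv
      fun x => (norm_inner_le_norm _ _).trans (mul_le_mul_of_nonneg_left (n_conv x) (norm_nonneg _))
  have j2 : ∀ i, Integrable (fun x => ⟪fderiv ℝ v x (e i), fderiv ℝ Cv x (e i)⟫) volume := fun i =>
    integrable_of_norm_le_mul_of_lintegral_sq ((cdiv i).inner (cdCv i)).aestronglyMeasurable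
      (cdiv i) (cdCv i) (l2div i) (l2dCv i) fun x => norm_inner_le_norm _ _
  have j3 : ∀ i, Integrable (fun x => ⟪fderiv ℝ v x (e i), Cv x⟫) volume := fun i =>
    integrable_of_norm_le_mul_of_lintegral_sq ((cdiv i).inner cconv).aestronglyMeasurable (cdiv i)
      cBDv (l2div i) l2BDv
      fun x => (norm_inner_le_norm _ _).trans (mul_le_mul_of_nonneg_left (n_conv x) (norm_nonneg _))
  have hJ := integral_sum_inner_fderiv_fderiv_eq_neg_integral_inner_laplacian hv2' hCv1 j1 j2 j3
  -- Step 5: the split `Σᵢ⟪∂ᵢv, ∂ᵢ((v·∇)v)⟫ = Σᵢ⟪∂ᵢv, D(∂ᵢv)(v)⟫ + (3 det ∇v − ⟪ω, ∇v ω⟫)`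
  have iT : ∀ i, Integrable (fun x => ⟪fderiv ℝ v x (e i),
      fderiv ℝ (fun y => fderiv ℝ v y (e i)) x (v x)⟫) volume := fun i =>
    integrable_of_norm_le_mul_of_lintegral_sq ((cdiv i).inner (cDfi i)).aestronglyMeasurable
      (cdiv i) (cD2.const_smul B) (l2div i) l2B2
      fun x => (norm_inner_le_norm _ _).trans (mul_le_mul_of_nonneg_left (n_Dfi i x) (norm_nonneg _))
  have iC : ∀ i, Integrable (fun x => ⟪fderiv ℝ v x (e i), fderiv ℝ v x (fderiv ℝ v x (e i))⟫)
      volume := fun i =>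
    integrable_of_norm_le_mul_of_lintegral_sq ((cdiv i).inner (cDv.clm_apply (cdiv i))).aestronglyMeasurable
      (cdiv i) cKDv (l2div i) l2KDv
      fun x => (norm_inner_le_norm _ _).trans (mul_le_mul_of_nonneg_left (n_AA i x) (norm_nonneg _))
  have hsplit : ∫ x, ∑ i, ⟪fderiv ℝ v x (e i), fderiv ℝ Cv x (e i)⟫ =
      (∫ x, ∑ i, ⟪fderiv ℝ v x (e i), fderiv ℝ (fun y => fderiv ℝ v y (e i)) x (v x)⟫) +
        ∫ x, ∑ i, ⟪fderiv ℝ v x (e i), fderiv ℝ v x (fderiv ℝ v x (e i))⟫ := by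
    rw [← integral_add (integrable_finsetSum _ fun i _ => iT i) (integrable_finsetSum _ fun i _ => iC i)]
    refine integral_congr_ae (Eventually.of_forall fun x => ?_)
    simp only [← Finset.sum_add_distrib]
    refine Finset.sum_congr rfl fun i _ => ?_
    rw [hDCv x i, inner_add_right]
  have hT := integral_sum_inner_fderiv_transport_eq_zero hv hdiv hB hv1 hv2
  -- the cubic term: `∫ Σᵢ ⟪Aeᵢ, A(Aeᵢ)⟫ = ∫ (3 det A − ⟪ω, Aω⟫) = -∫ ⟪ω, Aω⟫`
  have hfrob_int : Integrable (fun x => frobeniusNormSq (fderiv ℝ v x)) volume := by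
    have lfrob : ∫⁻ x, ENNReal.ofReal (FluidPDE.frobeniusNormSq (fderiv ℝ v x)) < ⊤ :=
      calc ∫⁻ x, ENNReal.ofReal (FluidPDE.frobeniusNormSq (fderiv ℝ v x))
          ≤ ∫⁻ x, 3 * ‖fderiv ℝ v x‖ₑ ^ 2 :=
            lintegral_mono fun x => ofReal_frobeniusNormSq_le_three_mul_enorm_sq _
        _ = 3 * ∫⁻ x, ‖fderiv ℝ v x‖ₑ ^ 2 := lintegral_const_mul' _ _ (by norm_num)
        _ < ⊤ := ENNReal.mul_lt_top (by norm_num) l2Dv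
    exact integrable_of_continuous_of_nonneg (FluidPDE.continuous_frobeniusNormSq_fderiv hv (by simp))
      (fun x => FluidPDE.frobeniusNormSq_nonneg _) lfrob
  have hdet0 : ∫ x, (fderiv ℝ v x).det = 0 := integral_det_fderiv_eq_zero hv2' hB hK hfrob_int
  have cP : Continuous fun x => ⟪curl v x, fderiv ℝ v x (curl v x)⟫ :=
    (continuous_curl hv1').inner (cDv.clm_apply (continuous_curl hv1'))
  have cdet : Continuous fun x => (fderiv ℝ v x).det := ContinuousLinearMap.continuous_det.comp cDv
  have idet : Integrable (fun x => (fderiv ℝ v x).det) volume := by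
    refine Integrable.mono' (hfrob_int.const_mul ((1 / 2) * K)) cdet.aestronglyMeasurable
      (Eventually.of_forall fun x => ?_)
    rw [Real.norm_eq_abs]
    calc |(fderiv ℝ v x).det| ≤ (1 / 2) * ‖fderiv ℝ v x‖ * frobeniusNormSq (fderiv ℝ v x) :=
          abs_det_fderiv_le (hdv x)
      _ ≤ (1 / 2) * K * frobeniusNormSq (fderiv ℝ v x) := by
          gcongr
          · exact frobeniusNormSq_nonneg _
          · exact hK x
  have iP : Integrable (fun x => ⟪curl v x, fderiv ℝ v x (curl v x)⟫) volume := by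
    have hcubic_int : Integrable (fun x => ∑ i, ⟪fderiv ℝ v x (e i), fderiv ℝ v x (fderiv ℝ v x (e i))⟫)
        volume := integrable_finsetSum _ fun i _ => iC i
    have heq : (fun x => ⟪curl v x, fderiv ℝ v x (curl v x)⟫) =
        fun x => 3 * (fderiv ℝ v x).det - ∑ i, ⟪fderiv ℝ v x (e i), fderiv ℝ v x (fderiv ℝ v x (e i))⟫ := by
      funext x; rw [cubic_identity v x (hdiv x)]; ring
    rw [heq]
    exact (idet.const_mul 3).sub hcubic_int
  have hcubic : ∫ x, ∑ i, ⟪fderiv ℝ v x (e i), fderiv ℝ v x (fderiv ℝ v x (e i))⟫ =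
      -∫ x, ⟪curl v x, fderiv ℝ v x (curl v x)⟫ := by
    have heq : ∀ x, ∑ i, ⟪fderiv ℝ v x (e i), fderiv ℝ v x (fderiv ℝ v x (e i))⟫ =
        3 * (fderiv ℝ v x).det - ⟪curl v x, fderiv ℝ v x (curl v x)⟫ := fun x =>
      cubic_identity v x (hdiv x)
    rw [integral_congr_ae (Eventually.of_forall heq), integral_sub (idet.const_mul 3) iP,
      integral_const_mul, hdet0, mul_zero, zero_sub]
  -- Step 6: assemble
  rw [← he] at hL hJ hT
  have hJ' : ∫ x, ⟪(Δ v) x, Cv x⟫ = ∫ x, ⟪curl v x, fderiv ℝ v x (curl v x)⟫ := by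
    have h := hJ
    rw [hsplit, hT, zero_add, hcubic] at h
    linarith
  rw [hL, hΔW, hJ']
  ring

/-- **The enstrophy production identity, registered helper-stub form** (the `∀`-closed statement of
`enstrophy_production_identity`). [cite: LemarieRieusset2016, Thm. 11.2 with (11.9)] -/
theorem enstrophy_production :
    ∀ (ν : ℝ) (v W : EuclideanSpace ℝ (Fin 3) → EuclideanSpace ℝ (Fin 3)) (q : EuclideanSpace ℝ (Fin 3) → ℝ),
      ContDiff ℝ 3 v → ContDiff ℝ 1 W → ContDiff ℝ 1 q →
      (∀ x, W x + FluidPDE.convect v v x = ν • (Δ v) x - gradient q x) →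
      VectorCalculus.IsDivFree v → (∃ B : ℝ, ∀ x, ‖v x‖ ≤ B) → (∃ K : ℝ, ∀ x, ‖fderiv ℝ v x‖ ≤ K) →
      (∫⁻ x, ‖iteratedFDeriv ℝ 1 v x‖ₑ ^ 2 < ⊤) → (∫⁻ x, ‖iteratedFDeriv ℝ 2 v x‖ₑ ^ 2 < ⊤) →
      (∫⁻ x, ‖iteratedFDeriv ℝ 3 v x‖ₑ ^ 2 < ⊤) →
      (∫⁻ x, ‖W x‖ₑ ^ 2 < ⊤) → (∫⁻ x, ‖iteratedFDeriv ℝ 1 W x‖ₑ ^ 2 < ⊤) →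
      (∫⁻ x, ‖q x‖ₑ ^ 2 < ⊤) → (∫⁻ x, ‖iteratedFDeriv ℝ 1 q x‖ₑ ^ 2 < ⊤) →
      ∫ x, ∑ i, inner ℝ (fderiv ℝ v x (EuclideanSpace.basisFun (Fin 3) ℝ i))
          (fderiv ℝ W x (EuclideanSpace.basisFun (Fin 3) ℝ i)) =
        -(ν * ∫ x, ‖(Δ v) x‖ ^ 2) + ∫ x, inner ℝ (curl v x) (fderiv ℝ v x (curl v x)) := by
  intro ν v W q hv hW hq hmom hdiv hB hK hv1 hv2 hv3 hW0 hW1 hq0 hq1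
  obtain ⟨B, hB⟩ := hB
  obtain ⟨K, hK⟩ := hK
  exact enstrophy_production_identity hv hW hq hmom hdiv hB hK hv1 hv2 hv3 hW0 hW1 hq0 hq1

end Summit.NavierStokesRegularity.NavierStokesRegularity.Theorems.ClassBudgetsRegularise

end
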